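import Summits.RiemannHypothesis.RiemannHypothesis.Theorems.JensenPolynomialsFarGumbelDefs
import Literature.NumberTheory.LFunctions.DeBruijnPhiComplex

/-!
# Route `JensenPolynomials`, FAR crux `XiWindowZeroFreeRelFar` (B1-rel far) — S3 step 2: the far phase `Ψ` in the
`u`-variable, its three derivatives, and the factorisation of the contour integrand (RH-FREE; cell rh-jensen, D-0040)

For stub S3 `stub_laplaceFar` of theory g8's line «far-gumbel» (skeleton v3, item `stmt-RiemannHypothesis-19465`) the
integrand of `winJ M υ a` continued to the strip is `Φ_C(u)·u·(u² + a)^{M−½}`. Off the leading Gaussian-type factor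
`a₁⁰(u) = 2π²e^{9u}e^{−πe^{4u}}` of the kernel it is `exp Ψ(u)` with the FAR PHASE

  `Ψ(u) = log(2π²) + 9u − πe^{4u} + Log u + (M−½)·Log(u² + a)`      (`farPsi`),

holomorphic where `Re u > 0` and `Re(u² + a) > 0` (the half-strip of `JensenPolynomialsFarGumbelShift`), with explicit
derivatives `Ψ′ = 9 − 4πe^{4u} + 1/u + (2M−1)u/(u²+a)` (`farPsi1`; the far-mode equation `4πe^{4υ}υ = 2M + 9υ` is `Ψ′(υ) = 0`
at `a = 0`), `Ψ″ = −16πe^{4u} − 1/u² + (2M−1)(a − u²)/(u²+a)²` (`farPsi2`), `Ψ‴ = −64πe^{4u} + 2/u³ + (2M−1)(2u³ − 6ua)/(u²+a)³`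
(`farPsi3`), each as a `HasDerivAt` statement (`hasDerivAt_farPsi`, `hasDerivAt_farPsi1`, `hasDerivAt_farPsi2`), and the
factorisation `exp Ψ(u) = 2π²e^{9u}e^{−πe^{4u}}·u·(u²+a)^{M−½}` (`exp_farPsi`). These are the inputs of the Taylor brick
`WindowEGF.cubic_window_of_hasDerivAt`, the saddle brick `WindowEGF.exists_zero_near_of_hasDerivAt` (applied to `Ψ′`) and the
Laplace window `WindowEGF.norm_integral_window_phase_sub_main_le`.
WHAT THIS IS NOT: calculus of an explicit elementary function; nothing here bears on the zeros of `ζ` or the truth of RH.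
-/

noncomputable section
-- D-0017: `Summit.RiemannHypothesis.RiemannHypothesis.…` duplicates the namespace BY DESIGN (single-problem summit).
set_option linter.dupNamespace false

namespace Summit.RiemannHypothesis.RiemannHypothesis.Theorems.JensenPolynomials.FarGumbel

open Literature.NumberTheory.LFunctions Complex
open scoped Real

/-! ## 1. The far phase and its derivatives -/

/-- THE FAR PHASE `Ψ(u) = log(2π²) + 9u − πe^{4u} + Log u + (M−½)·Log(u² + a)` (`u`-variable; `exp Ψ = 2π²e^{9u}e^{−πe^{4u}}·u·(u²+a)^{M−½}`). -/
def farPsi (M : ℕ) (a u : ℂ) : ℂ :=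
  Complex.log (2 * (π : ℂ) ^ 2) + 9 * u - (π : ℂ) * Complex.exp (4 * u) + Complex.log u +
    ((M : ℂ) - 1 / 2) * Complex.log (u ^ 2 + a)

/-- `Ψ′(u) = 9 − 4πe^{4u} + 1/u + (2M−1)·u/(u²+a)`. -/
def farPsi1 (M : ℕ) (a u : ℂ) : ℂ :=
  9 - 4 * (π : ℂ) * Complex.exp (4 * u) + 1 / u + (2 * (M : ℂ) - 1) * u / (u ^ 2 + a)

/-- `Ψ″(u) = −16πe^{4u} − 1/u² + (2M−1)·(a − u²)/(u²+a)²`. -/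
def farPsi2 (M : ℕ) (a u : ℂ) : ℂ :=
  -16 * (π : ℂ) * Complex.exp (4 * u) - 1 / u ^ 2 + (2 * (M : ℂ) - 1) * (a - u ^ 2) / (u ^ 2 + a) ^ 2

/-- `Ψ‴(u) = −64πe^{4u} + 2/u³ + (2M−1)·(2u³ − 6ua)/(u²+a)³`. -/
def farPsi3 (M : ℕ) (a u : ℂ) : ℂ :=
  -64 * (π : ℂ) * Complex.exp (4 * u) + 2 / u ^ 3 + (2 * (M : ℂ) - 1) * (2 * u ^ 3 - 6 * u * a) / (u ^ 2 + a) ^ 3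

/-- `d/du [πe^{4u}] = 4πe^{4u}`. -/
theorem hasDerivAt_pi_mul_exp_four (u : ℂ) :
    HasDerivAt (fun u : ℂ => (π : ℂ) * Complex.exp (4 * u)) (4 * (π : ℂ) * Complex.exp (4 * u)) u := by
  have h : HasDerivAt (fun u : ℂ => Complex.exp (4 * u)) (Complex.exp (4 * u) * 4) u :=
    ((hasDerivAt_id u).const_mul 4 |>.congr_deriv (by simp)).cexp
  exact (h.const_mul (π : ℂ)).congr_deriv (by ring)

/-- **`Ψ → Ψ′`**: for `Re u > 0` and `u² + a` in the slit plane, `HasDerivAt (Ψ M a) (Ψ′ M a u) u`. -/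
theorem hasDerivAt_farPsi (M : ℕ) (a : ℂ) {u : ℂ} (hu : 0 < u.re) (hs : u ^ 2 + a ∈ slitPlane) :
    HasDerivAt (farPsi M a) (farPsi1 M a u) u := by
  have hu0 : u ≠ 0 := fun h => by rw [h, Complex.zero_re] at hu; exact lt_irrefl _ hu
  have hs0 : u ^ 2 + a ≠ 0 := fun h => Complex.zero_notMem_slitPlane (h ▸ hs)
  have h1 : HasDerivAt (fun u : ℂ => 9 * u) 9 u := by simpa using (hasDerivAt_id u).const_mul (9 : ℂ)
  have h2 := hasDerivAt_pi_mul_exp_four u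
  have h3 : HasDerivAt Complex.log (1 / u) u := by
    simpa [one_div] using Complex.hasDerivAt_log (mem_slitPlane_iff.2 (Or.inl hu))
  have h4 : HasDerivAt (fun u : ℂ => u ^ 2 + a) (2 * u) u := by
    simpa using ((hasDerivAt_id u).pow 2).add_const a
  have h5 : HasDerivAt (fun u : ℂ => Complex.log (u ^ 2 + a)) (2 * u / (u ^ 2 + a)) u := h4.clog hs
  have h6 := h5.const_mul ((M : ℂ) - 1 / 2)
  have h := (((h1.const_add (Complex.log (2 * (π : ℂ) ^ 2))).sub h2).add h3).add h6
  refine (h.congr_deriv ?_).congr_of_eventuallyEq (Filter.Eventually.of_forall fun v => by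
    simp only [farPsi, Pi.add_apply, Pi.sub_apply]; try ring)
  rw [farPsi1]
  field_simp
  try ring

/-- **`Ψ′ → Ψ″`**. -/
theorem hasDerivAt_farPsi1 (M : ℕ) (a : ℂ) {u : ℂ} (hu : 0 < u.re) (hs : u ^ 2 + a ∈ slitPlane) :
    HasDerivAt (farPsi1 M a) (farPsi2 M a u) u := by
  have hu0 : u ≠ 0 := fun h => by rw [h, Complex.zero_re] at hu; exact lt_irrefl _ hu
  have hs0 : u ^ 2 + a ≠ 0 := fun h => Complex.zero_notMem_slitPlane (h ▸ hs)
  have h2 := (hasDerivAt_pi_mul_exp_four u).const_mul (4 : ℂ)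
  have h3 : HasDerivAt (fun u : ℂ => 1 / u) (-(1 / u ^ 2)) u := by
    simpa [one_div] using hasDerivAt_inv hu0
  have h4 : HasDerivAt (fun u : ℂ => u ^ 2 + a) (2 * u) u := by
    simpa using ((hasDerivAt_id u).pow 2).add_const a
  have h5 : HasDerivAt (fun u : ℂ => (2 * (M : ℂ) - 1) * u / (u ^ 2 + a))
      (((2 * (M : ℂ) - 1) * 1 * (u ^ 2 + a) - (2 * (M : ℂ) - 1) * u * (2 * u)) / (u ^ 2 + a) ^ 2) u :=
    (((hasDerivAt_id u).const_mul (2 * (M : ℂ) - 1)).congr_deriv (by simp)).div h4 hs0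
  have h := (((hasDerivAt_const u (9 : ℂ)).sub h2).add h3).add h5
  refine (h.congr_deriv ?_).congr_of_eventuallyEq (Filter.Eventually.of_forall fun v => by
    simp only [farPsi1, Pi.add_apply, Pi.sub_apply]; try ring)
  rw [farPsi2]
  field_simp
  try ring

/-- **`Ψ″ → Ψ‴`**. -/
theorem hasDerivAt_farPsi2 (M : ℕ) (a : ℂ) {u : ℂ} (hu : 0 < u.re) (hs : u ^ 2 + a ∈ slitPlane) :
    HasDerivAt (farPsi2 M a) (farPsi3 M a u) u := by
  have hu0 : u ≠ 0 := fun h => by rw [h, Complex.zero_re] at hu; exact lt_irrefl _ hu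
  have hs0 : u ^ 2 + a ≠ 0 := fun h => Complex.zero_notMem_slitPlane (h ▸ hs)
  have h2 := (hasDerivAt_pi_mul_exp_four u).const_mul (16 : ℂ)
  have h3 : HasDerivAt (fun u : ℂ => 1 / u ^ 2) (-(2 * u) / (u ^ 2) ^ 2) u := by
    have hp : HasDerivAt (fun u : ℂ => u ^ 2) (2 * u) u := by simpa using hasDerivAt_pow 2 u
    have := hp.inv (pow_ne_zero 2 hu0)
    exact this.congr_of_eventuallyEq (Filter.Eventually.of_forall fun y => by
      simp only [one_div, Pi.inv_apply])
  have h4 : HasDerivAt (fun u : ℂ => u ^ 2 + a) (2 * u) u := by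
    simpa using ((hasDerivAt_id u).pow 2).add_const a
  have h4' : HasDerivAt (fun u : ℂ => (u ^ 2 + a) ^ 2) (((2 : ℕ) : ℂ) * (u ^ 2 + a) ^ (2 - 1) * (2 * u)) u := h4.pow 2
  have hn : HasDerivAt (fun u : ℂ => (2 * (M : ℂ) - 1) * (a - u ^ 2)) ((2 * (M : ℂ) - 1) * (-(2 * u))) u := by
    have : HasDerivAt (fun u : ℂ => a - u ^ 2) (-(2 * u)) u := by
      simpa using ((hasDerivAt_id u).pow 2).const_sub a
    exact this.const_mul _
  have h5 := hn.div h4' (pow_ne_zero 2 hs0)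
  have h := ((h2.neg.sub h3).add h5)
  refine (h.congr_deriv ?_).congr_of_eventuallyEq (Filter.Eventually.of_forall fun v => by
    simp only [farPsi2, Pi.add_apply, Pi.sub_apply, Pi.neg_apply, Pi.div_apply]
    field_simp
    try ring)
  rw [farPsi3]
  push_cast
  field_simp
  try ring

/-! ## 2. The factorisation of the integrand -/

/-- **`exp Ψ(u) = 2π²e^{9u}e^{−πe^{4u}} · u · (u² + a)^{M−½}`** for `u ≠ 0`, `u² + a ≠ 0` (principal power). -/
theorem exp_farPsi (M : ℕ) (a : ℂ) {u : ℂ} (hu0 : u ≠ 0) (hs0 : u ^ 2 + a ≠ 0) :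
    Complex.exp (farPsi M a u) =
      2 * (π : ℂ) ^ 2 * Complex.exp (9 * u) * Complex.exp (-((π : ℂ) * Complex.exp (4 * u))) * u *
        (u ^ 2 + a) ^ ((M : ℂ) - 1 / 2) := by
  have hπ : (2 * (π : ℂ) ^ 2) ≠ 0 := by
    have : (π : ℂ) ≠ 0 := by exact_mod_cast Real.pi_ne_zero
    exact mul_ne_zero two_ne_zero (pow_ne_zero 2 this)
  rw [farPsi, cpow_def_of_ne_zero hs0]
  simp only [Complex.exp_add, Complex.exp_sub, Complex.exp_log hπ, Complex.exp_log hu0]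
  rw [show Complex.log (u ^ 2 + a) * ((M : ℂ) - 1 / 2) = ((M : ℂ) - 1 / 2) * Complex.log (u ^ 2 + a) by ring]
  have hexp : Complex.exp ((π : ℂ) * Complex.exp (4 * u)) ≠ 0 := Complex.exp_ne_zero _
  field_simp
  rw [Complex.exp_neg]
  field_simp

end Summit.RiemannHypothesis.RiemannHypothesis.Theorems.JensenPolynomials.FarGumbel

end
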